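import Literature.NumberTheory.Automorphic.HyperspecialUnitarySatakeInjective
import Literature.NumberTheory.Automorphic.HyperspecialUnitarySatakeIwasawaDatum
import Literature.NumberTheory.Automorphic.HyperspecialUnitaryCartanUnique
import Literature.NumberTheory.Automorphic.CartanIwasawaUniquenessGL
import HarnessLib

/-!
# Bruhat–Tits (4.4.4) (ii) for the quasi-split unitary group `U(σ, J₀)`: the ANTIDOMINANT coset of `K₀ diag(ϖ^a) K₀` is
# unique, and the Satake transform of `ℋ(U(σ, J₀), K₀; R)` is injective over EVERY commutative ring `R`

Topic `NumberTheory/Automorphic`; namespaces `Literature.NumberTheory.Automorphic.CartanUnique` (§1, plain matrices over a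
field `K` with `Valued K ℤᵐ⁰`) and `Literature.NumberTheory.Automorphic.HermitianLattice.UnramifiedLocalConjDatum` (§§2–6)
(lane `lit-hodgefound`, Track 2 foundations; seat `lit-hodgefound-p11`, generation 43, row g43-#3).  THEOREMS ONLY: no
definition, no named fact, no instance, no notation.  The unitary counterpart of the tree's `CartanIwasawaUniquenessGL`
(g42-#1, `GL_n`): there the multiplicity-one statement (ii) of Bruhat–Tits (4.4.4) fed the abstract injectivity criterion
`IsIwasawaExponent.satakeTransform_injective_of_unique` (hypotheses CARTAN + SEPARATION + DOMINANCE + UNIQUENESS, any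
commutative coefficient ring); here the four hypotheses are established for the Iwasawa datum `hd.isIwasawaExponent` of the
unramified unitary group (`HyperspecialUnitarySatakeIwasawaDatum`) with the ANTIDOMINANT Cartan representatives
`diag(ϖ^c)`, `c` MONOTONE and antisymmetric (`c ∘ rev = -c`).  The tree had, for `U(σ, J₀)`, only (4.4.4) (i) from the
dominant end (`HyperspecialUnitaryIwasawaCartan.sum_iwasawaExp_head_le`: `a(γ) ≤ b`, `b` antitone) and the injectivity of the
`ℂ`-valued transform (`HyperspecialUnitarySatakeInjective`, leading count `≠ 0` in characteristic `0`).

Setting: `K` a field with `Valued K ℤᵐ⁰`, `hd : UnramifiedLocalConjDatum σ ϖ`, `G = U(σ, J₀) = unitaryGroupOfForm σ (J₀.over K)`,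
`K₀ = unitaryInt σ (J₀.over K)`, `a(g) = hd.iwasawaExp g` (`g ∈ N · diag(ϖ^{a(g)}) · K₀`), `P_rev = permGL rev ∈ K₀` the longest
Weyl element.

## The print

[BruhatTits1972] Prop. (4.4.4) (held `paper:doi-10-1007-bf02715544`, p. 80): «Soit `K` un bon sous-groupe borné maximal […]
`t ∈ V_D`, `t' ∈ V`. (i) Si `K.t.K ∩ B̂⁰.t'.K ≠ ∅`, on a `t' ≤ t` […] (ii) On a `K.t.K ∩ B̂⁰.t.K = t.K`.»  With `B̂⁰ ⊇ N` the
upper unitriangular elements and `t = diag(ϖ^c)` normalised ANTIDOMINANT (`c` monotone; the Weyl chamber for which the unique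
coset is the one `N` sees first), (i) reads `∑_{i<r} c_i ≤ ∑_{i<r} a(γ)_i` for every coset `γ ⊆ K₀ t K₀` and (ii) reads: the
only such `γ` with `a(γ) = c` is `tK₀`.  [CartierCorvallis1979] §IV, proof of Thm. 4.1 (c): «`c(λ, λ) = δ(λ)^{1/2}`» — the
leading coefficient of `S c_λ` is the weight, with multiplicity one; [Macdonald1995] Ch. V (2.6)–(2.7) (`GL_n`).

## The proof formalised (minors, as for `GL_n`)

Write `g = u t' k` (Iwasawa) and `g = A t B` (`A, B ∈ K₀`), `t = P_rev diag(ϖ^{-c}) P_rev⁻¹` with `-c` antitone; then the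
upper triangular `u t' = (A P_rev) diag(ϖ^{-c}) (P_rev⁻¹ B) k⁻¹` has all its `r × r` minors of valuation `≤ exp(-s_r)`,
`s_r = ∑_{i ≥ N-r} (-c)_i = ∑_{i<r} c_i` (`CartanUnique.v_det_submatrix_le_of_eq_mul_diagonal_mul`).  (§3) Its upper-left corner
minor is `∏_{i<r} (u t')_{ii}`, of valuation `exp(-∑_{i<r} a(g)_i)` — whence `∑_{i<r} c_i ≤ ∑_{i<r} a(g)_i`.  (§4) If `a(g) = c`
then `t' = t`, `v = t⁻¹ u t` is upper unitriangular with `u t = t v`, and the minor of `t v = diag(ϖ^c) v` with rows `0..i`,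
columns `0..i-1, j` (`i < j`) is `ϖ^{c_0 + ⋯ + c_i} v_{ij}` (`det_submatrix_castSucc_of_upperUnitriangular`, g42-#1), so
`|v_{ij}| ≤ 1`; `v` has determinant `1`, so `v⁻¹ = adj v` is integral too (§1) and `v ∈ K₀`, i.e. `gK₀ = u t K₀ = t v K₀ = tK₀`.

## What is formalised

* §1 `CartanUnique.v_det_le_one_of_forall_v_le_one`, `v_adjugate_apply_le_one`, **`v_inv_apply_le_one_of_det_eq_one`**
  (an integral matrix of determinant `1` over a valued field has an integral inverse).
* §2 `sum_ite_lt_neg`, `permGL_rev_mul_zpowDiagGL_neg_mul_inv` (`P_rev diag(ϖ^{-c}) P_rev⁻¹ = diag(ϖ^c)` for antisymmetric `c`).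
* §3 `exists_upper_eq_mul_diagonal_mul` (the common set-up), **`sum_ite_lt_le_sum_iwasawaExp_of_mem_orbit`** ((4.4.4) (i) from
  the antidominant end: `∑_{i<r} c_i ≤ ∑_{i<r} a(γ)_i`).
* §4 **`coe_eq_coe_of_mem_orbit_of_iwasawaExp_eq`**, `eq_coe_of_mem_orbit_of_iwasawaExp_out_eq` ((4.4.4) (ii): the coset of
  `K₀ t K₀` with exponents `c` is `tK₀`).
* §5 the antidominant datum: `exists_zpowDiagGL_monotone_mem_orbit_unitary` (CARTAN), `injOn_iwasawaExp_zpowDiagGL_monotone_unitary`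
  (SEPARATION), `iwasawaExp_eq_or_headSum_gt_unitary` (DOMINANCE), `eq_coe_of_mem_orbit_zpowDiagGL_monotone_unitary` (UNIQUENESS);
  **`satakeTransform_injective_of_commRing`** — THE SATAKE TRANSFORM `hd.isIwasawaExponent.satakeTransform w` OF
  `ℋ(U(σ, J₀), K₀; R)` IS INJECTIVE FOR EVERY WEIGHT `w` AND EVERY COMMUTATIVE RING `R`; `eq_zero_of_satakeTransform_eq_zero_of_commRing`.
* §6 **`coeff_satakeTransform_doubleCosetOperator_zpowDiagGL_monotone_unitary`** (the coefficient of `x^c` in `𝒮_w(T_t)` is the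
  unit `w(c)`), `card_filter_iwasawaExp_orbit_eq_one_unitary` (`#{γ ⊆ K₀tK₀ : a(γ) = c} = 1`),
  `coeff_unitarySatakeTransform_doubleCosetOperator_zpowDiagGL_monotone` (for the tree's `ℂ`-valued `hd.satakeTransform`: the
  coefficient is `(√q)^{-⟨ν, c⟩} = satakeWeight (√q) c`).

## References
* [BruhatTits1972] F. Bruhat, J. Tits, *Groupes réductifs sur un corps local I*, Publ. Math. IHÉS 41 (1972), Prop. (4.4.4) (p. 80).
* [CartierCorvallis1979] P. Cartier, *Representations of 𝔭-adic groups: a survey*, PSPM 33.1 (1979), §IV (4.2), Thm. 4.1,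
  proof (b)–(c).
* [Macdonald1995] I. G. Macdonald, *Symmetric Functions and Hall Polynomials*, 2nd ed. (1995), Ch. II §1, Ch. V (2.6)–(2.7).
* [Tits1979] J. Tits, *Reductive groups over local fields*, PSPM 33.1 (1979), §3.3.3 (the relative Weyl group of `U(σ, J₀)`).
* [Minguez2011] A. Mínguez, *Unramified representations of unitary groups* (2011), §4.
-/

noncomputable section

open scoped Valued WithZero Matrix MatrixGroups
open MonoidAlgebra Representation Finset MulAction

/-! ## §1 Integral matrices over a valued field: determinant, adjugate, inverse -/

namespace Literature.NumberTheory.Automorphic.CartanUnique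

variable {K : Type*} [Field K] [Valued K ℤᵐ⁰] {ι : Type*} [Fintype ι] [DecidableEq ι]

/-- The determinant of an integral matrix is integral. [cite: Macdonald1995, Ch. II §1] -/
theorem v_det_le_one_of_forall_v_le_one {M : Matrix ι ι K} (hM : ∀ i j, Valued.v (M i j) ≤ 1) : Valued.v M.det ≤ 1 := by
  rw [Matrix.det_apply']
  refine Valuation.map_sum_le _ fun τ _ => ?_
  have hsign : Valued.v (((Equiv.Perm.sign τ : ℤˣ) : ℤ) : K) ≤ 1 := by
    rcases Int.units_eq_one_or (Equiv.Perm.sign τ) with h | h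
    · rw [h, Units.val_one, Int.cast_one, map_one]
    · rw [h, Units.val_neg, Units.val_one, Int.cast_neg, Int.cast_one, Valuation.map_neg, map_one]
  rw [map_mul, map_prod]
  calc Valued.v (((Equiv.Perm.sign τ : ℤˣ) : ℤ) : K) * ∏ i, Valued.v (M (τ i) i) ≤ 1 * 1 :=
        mul_le_mul' hsign (Finset.prod_le_one' fun i _ => hM _ _)
    _ = 1 := one_mul 1

/-- The adjugate of an integral matrix is integral (its entries are minors). [cite: Macdonald1995, Ch. II §1] -/
theorem v_adjugate_apply_le_one {M : Matrix ι ι K} (hM : ∀ i j, Valued.v (M i j) ≤ 1) (i j : ι) :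
    Valued.v (M.adjugate i j) ≤ 1 := by
  rw [Matrix.adjugate_apply]
  refine v_det_le_one_of_forall_v_le_one fun i' j' => ?_
  rw [Matrix.updateRow_apply]
  split_ifs
  · rw [Pi.single_apply]
    split_ifs
    · rw [map_one]
    · rw [map_zero]; exact zero_le
  · exact hM _ _

/-- **An integral matrix of determinant `1` has an integral inverse** (the inverse is the adjugate). [cite: Macdonald1995, Ch. II §1] -/
theorem v_inv_apply_le_one_of_det_eq_one {M : Matrix ι ι K} (hM : ∀ i j, Valued.v (M i j) ≤ 1) (hdet : M.det = 1)
    (i j : ι) : Valued.v (M⁻¹ i j) ≤ 1 := by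
  have h : M⁻¹ = M.adjugate := Matrix.inv_eq_left_inv (by rw [Matrix.adjugate_mul, hdet, one_smul])
  rw [h]
  exact v_adjugate_apply_le_one hM i j

end Literature.NumberTheory.Automorphic.CartanUnique

namespace Literature.NumberTheory.Automorphic.HermitianLattice

open Literature.NumberTheory.Automorphic.CartanUnique Literature.NumberTheory.Automorphic.SymplecticCartan

variable {K : Type*} [Field K] [Valued K ℤᵐ⁰] {σ : K →+* K} {ϖ : K} {N : ℕ}

/-! ## §2 Head sums of negated vectors -/

omit [Valued K ℤᵐ⁰] in
/-- Head sums of `-c` are the negatives of the head sums of `c`. [cite: BruhatTits1972, (4.4.4)] -/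
theorem sum_ite_lt_neg (c : Fin N → ℤ) (r : ℕ) :
    (∑ i : Fin N, if (i : ℕ) < r then (fun j => -c j) i else 0) = -∑ i : Fin N, if (i : ℕ) < r then c i else 0 := by
  rw [← Finset.sum_neg_distrib]
  exact Finset.sum_congr rfl fun i _ => by split_ifs <;> simp

omit [Valued K ℤᵐ⁰] in
/-- For antisymmetric `c` (`c ∘ rev = -c`), conjugating `diag(ϖ^{-c})` by the longest Weyl element `P_rev` gives `diag(ϖ^c)`:
`P_rev diag(ϖ^{-c}) P_rev⁻¹ = diag(ϖ^c)`. [cite: BruhatTits1972, (4.4.3)] [cite: Tits1979, §3.3.3] -/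
theorem permGL_rev_mul_zpowDiagGL_neg_mul_inv (hϖ0 : ϖ ≠ 0) {c : Fin N → ℤ} (hc : ∀ i, c (Fin.rev i) = -c i) :
    (permGL (Fin.revPerm : Equiv.Perm (Fin N)) : GL (Fin N) K) * zpowDiagGL hϖ0 (fun i => -c i) *
        (permGL (Fin.revPerm : Equiv.Perm (Fin N)))⁻¹ = zpowDiagGL hϖ0 c := by
  rw [permGL_mul_zpowDiagGL_mul_inv]
  congr 1
  funext i
  rw [Function.comp_apply, Fin.revPerm_apply, hc, neg_neg]

namespace UnramifiedLocalConjDatum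

/-! ## §3 Bruhat–Tits (4.4.4) at the antidominant end: the lower bound on the head sums of the Iwasawa exponents -/

/-- **The common set-up of (4.4.4) for a coset `gK₀ ⊆ K₀ t K₀`, `(t : GL_N) = diag(ϖ^c)` with `c` MONOTONE and antisymmetric**:
writing `g = u · t' · k` (Iwasawa, `(t' : GL_N) = diag(ϖ^{a(g)})`), the upper triangular matrix `u t' = g k⁻¹` is
`k₁ · diag(ϖ^{-c}) · k₂ · k⁻¹` with `k₁ = A P_rev`, `k₂ = P_rev⁻¹ B` integral (`g = A t B`, `t = P_rev diag(ϖ^{-c}) P_rev⁻¹`,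
`-c` antitone) — the shape to which the minor bounds of `CartanUnique` apply. [cite: BruhatTits1972, (4.4.4)] -/
theorem exists_upper_eq_mul_diagonal_mul (hd : UnramifiedLocalConjDatum σ ϖ) {c : Fin N → ℤ}
    (hc : Monotone c ∧ ∀ i, c (Fin.rev i) = -c i) {t : unitaryGroupOfForm σ ((StdForm.antidiagonal N).over K)}
    (ht : (t : GL (Fin N) K) = zpowDiagGL (uniformizer_ne_zero hd.vϖ) c)
    {g : unitaryGroupOfForm σ ((StdForm.antidiagonal N).over K)}
    (hg : (g : unitaryGroupOfForm σ ((StdForm.antidiagonal N).over K) ⧸ unitaryInt σ ((StdForm.antidiagonal N).over K)) ∈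
      MulAction.orbit (unitaryInt σ ((StdForm.antidiagonal N).over K))
        ((t : unitaryGroupOfForm σ ((StdForm.antidiagonal N).over K) ⧸ unitaryInt σ ((StdForm.antidiagonal N).over K)))) :
    ∃ u t' k : unitaryGroupOfForm σ ((StdForm.antidiagonal N).over K),
      (u : GL (Fin N) K) ∈ upperUnitriangular (Fin N) K ∧
        (t' : GL (Fin N) K) = zpowDiagGL (uniformizer_ne_zero hd.vϖ) (hd.iwasawaExp g) ∧
          k ∈ unitaryInt σ ((StdForm.antidiagonal N).over K) ∧ g = u * t' * k ∧
      ∃ k₁ k₂ : Matrix (Fin N) (Fin N) K, (∀ i j, Valued.v (k₁ i j) ≤ 1) ∧ (∀ i j, Valued.v (k₂ i j) ≤ 1) ∧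
        (((u * t' : unitaryGroupOfForm σ ((StdForm.antidiagonal N).over K)) : GL (Fin N) K) : Matrix (Fin N) (Fin N) K) =
          k₁ * (Matrix.diagonal fun i => ϖ ^ (fun j => -c j) i) * k₂ *
            ((((k : unitaryGroupOfForm σ ((StdForm.antidiagonal N).over K)) : GL (Fin N) K)⁻¹ : GL (Fin N) K) :
              Matrix (Fin N) (Fin N) K) := by
  have hϖ := hd.vϖ
  have hϖ0 := uniformizer_ne_zero hϖ
  obtain ⟨A, hA, B, hB, hgAB⟩ := (heckeAlgebra.coe_mem_orbit_coe_iff (unitaryInt σ ((StdForm.antidiagonal N).over K)) _ _).1 hg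
  obtain ⟨u, t', k, hu, ht', hk, hutk⟩ := hd.iwasawaExp_spec g
  refine ⟨u, t', k, hu, ht', hk, hutk, ?_⟩
  -- the longest Weyl element and the antitone torus element `diag(ϖ^{-c})`
  have hrev : ∀ i : Fin N, (Fin.revPerm : Equiv.Perm (Fin N)) (Fin.rev i) = Fin.rev (Fin.revPerm i) := fun i => rfl
  set P : unitaryGroupOfForm σ ((StdForm.antidiagonal N).over K) :=
    ⟨permGL Fin.revPerm, permGL_mem_unitaryGroupOfForm Fin.revPerm hrev⟩ with hP_def
  have hP : P ∈ unitaryInt σ ((StdForm.antidiagonal N).over K) := permGL_mem_unitaryInt (K := K) (σ := σ) Fin.revPerm hrev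
  have hc' : ∀ i, (fun j => -c j) (Fin.rev i) = -(fun j => -c j) i := fun i => by simp only [hc.2 i, neg_neg]
  set tb : unitaryGroupOfForm σ ((StdForm.antidiagonal N).over K) :=
    ⟨zpowDiagGL hϖ0 (fun j => -c j), zpowDiagGL_mem_unitaryGroupOfForm hd.σϖ _ hc'⟩ with htb_def
  have htconj : t = P * tb * P⁻¹ := Subtype.ext (by
    rw [ht, Subgroup.coe_mul, Subgroup.coe_mul, Subgroup.coe_inv]
    exact (permGL_rev_mul_zpowDiagGL_neg_mul_inv hϖ0 hc.2).symm)
  have hbk0 : u * t' = g * k⁻¹ := by rw [hutk, mul_inv_cancel_right]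
  have hbk : u * t' = (A * P) * tb * (P⁻¹ * B) * k⁻¹ := by
    rw [hbk0, hgAB, htconj]
    group
  refine ⟨(((A * P : unitaryGroupOfForm σ ((StdForm.antidiagonal N).over K)) : GL (Fin N) K) : Matrix (Fin N) (Fin N) K),
    (((P⁻¹ * B : unitaryGroupOfForm σ ((StdForm.antidiagonal N).over K)) : GL (Fin N) K) : Matrix (Fin N) (Fin N) K),
    (mem_unitaryInt_iff.1 ((unitaryInt σ _).mul_mem hA hP)).1,
    (mem_unitaryInt_iff.1 ((unitaryInt σ _).mul_mem ((unitaryInt σ _).inv_mem hP) hB)).1, ?_⟩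
  rw [hbk, Subgroup.coe_mul, Subgroup.coe_mul, Subgroup.coe_mul, Subgroup.coe_inv, Units.val_mul, Units.val_mul,
    Units.val_mul, htb_def, coe_zpowDiagGL]

/-- **BRUHAT–TITS (4.4.4) FOR `U(σ, J₀)`, ANTIDOMINANT FORM: the Iwasawa exponents of a coset `gK₀ ⊆ K₀ diag(ϖ^c) K₀`, `c`
MONOTONE (antidominant) and antisymmetric, are dominance-ABOVE `c`**: `∑_{i<r} c_i ≤ ∑_{i<r} a(g)_i` for every `r` (the
upper-left `r × r` corner minor `∏_{i<r} (u t')_{ii}`, of valuation `|ϖ|^{∑_{i<r} a(g)_i}`, against the bound `|ϖ|^{s_r}` on all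
`r × r` minors of `K₀ diag(ϖ^{-c}) K₀ · K₀`, `s_r` = the sum of the `r` smallest exponents `= ∑_{i<r} c_i`).  The tree's
`sum_iwasawaExp_head_le` is the bound from the dominant end (`a(g) ≤ -c ∘ rev`-type); this is the bound from the
antidominant end needed for the multiplicity-one statement. [cite: BruhatTits1972, (4.4.4) (i)] [cite: Macdonald1995, Ch. V (2.6)] -/
theorem sum_ite_lt_le_sum_iwasawaExp_of_mem_orbit (hd : UnramifiedLocalConjDatum σ ϖ) {c : Fin N → ℤ}
    (hc : Monotone c ∧ ∀ i, c (Fin.rev i) = -c i) {t : unitaryGroupOfForm σ ((StdForm.antidiagonal N).over K)}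
    (ht : (t : GL (Fin N) K) = zpowDiagGL (uniformizer_ne_zero hd.vϖ) c)
    {g : unitaryGroupOfForm σ ((StdForm.antidiagonal N).over K)}
    (hg : (g : unitaryGroupOfForm σ ((StdForm.antidiagonal N).over K) ⧸ unitaryInt σ ((StdForm.antidiagonal N).over K)) ∈
      MulAction.orbit (unitaryInt σ ((StdForm.antidiagonal N).over K))
        ((t : unitaryGroupOfForm σ ((StdForm.antidiagonal N).over K) ⧸ unitaryInt σ ((StdForm.antidiagonal N).over K))))
    (r : ℕ) :
    (∑ i : Fin N, if (i : ℕ) < r then c i else 0) ≤ ∑ i : Fin N, if (i : ℕ) < r then hd.iwasawaExp g i else 0 := by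
  -- reduce to `r ≤ N`
  wlog hr : r ≤ N generalizing r
  · have h := this N le_rfl
    have h1 : ∀ f : Fin N → ℤ, (∑ i : Fin N, if (i : ℕ) < r then f i else 0) = ∑ i : Fin N, if (i : ℕ) < N then f i else 0 :=
      fun f => Finset.sum_congr rfl fun i _ => by rw [if_pos (by omega), if_pos i.isLt]
    rw [h1, h1]
    exact h
  have hϖ := hd.vϖ
  have hϖ0 := uniformizer_ne_zero hϖ
  obtain ⟨u, t', k, hu, ht', hk, hutk, k₁, k₂, hk₁, hk₂, hmat⟩ := hd.exists_upper_eq_mul_diagonal_mul hc ht hg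
  have hanti : Antitone (fun j => -c j) := fun i j hij => neg_le_neg (hc.1 hij)
  have hc' : ∀ i, (fun j => -c j) (Fin.rev i) = -(fun j => -c j) i := fun i => by simp only [hc.2 i, neg_neg]
  -- the upper triangular `u t' = g k⁻¹` and its diagonal
  have hbk : u * t' = g * k⁻¹ := by rw [hutk, mul_inv_cancel_right]
  have hbT : (((u * t' : unitaryGroupOfForm σ ((StdForm.antidiagonal N).over K)) : GL (Fin N) K) :
      Matrix (Fin N) (Fin N) K).BlockTriangular id := by
    rw [Subgroup.coe_mul, ht']
    exact blockTriangular_mul_zpowDiagGL hu hϖ0 _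
  have hdiag : ∀ i, Valued.v ((((u * t' : unitaryGroupOfForm σ ((StdForm.antidiagonal N).over K)) : GL (Fin N) K) :
      Matrix (Fin N) (Fin N) K) i i) = WithZero.exp (-hd.iwasawaExp g i) := fun i => by
    rw [hd.v_apply_self_eq_exp_neg_iwasawaExp hbT i, hbk, hd.iwasawaExp_mul_of_mem_unitaryInt g (Subgroup.inv_mem _ hk)]
  -- the corner minor against the bound
  have h1 := v_det_submatrix_le_of_eq_mul_diagonal_mul hϖ hanti hk₁ hk₂ (mem_unitaryInt_iff.1 hk).2 hmat
    (fun j : Fin r => (⟨j, by omega⟩ : Fin N)) (fun j : Fin r => (⟨j, by omega⟩ : Fin N))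
  rw [det_submatrix_first_of_blockTriangular hbT hr, map_prod] at h1
  simp_rw [hdiag] at h1
  rw [prod_exp_neg_eq, sum_first_eq_sum_ite hr (fun i => hd.iwasawaExp g i), WithZero.exp_le_exp, neg_le_neg_iff,
    sum_ite_rev_eq_neg hc', sum_ite_lt_neg, neg_neg] at h1
  exact h1

/-! ## §4 Bruhat–Tits (4.4.4) (ii): the antidominant coset is unique -/

/-- **BRUHAT–TITS (4.4.4) (ii) FOR `U(σ, J₀)`** («`K.t.K ∩ B̂⁰.t.K = t.K`»): if the coset `gK₀` lies in `K₀ t K₀`,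
`(t : GL_N) = diag(ϖ^c)` with `c` MONOTONE and antisymmetric, and its Iwasawa exponents are `a(g) = c` (`g ∈ N · t · K₀`), then
`gK₀ = tK₀`.  Proof by minors as for `GL_n` (`CartanIwasawaUniquenessGL`): `g = u t k`, `v = t⁻¹ u t` is upper unitriangular
with `t v = g k⁻¹ ∈ K₀ diag(ϖ^{-c}) K₀ · K₀`, and the `(i+1) × (i+1)` minor of `t v` with rows `0..i` and columns `0..i-1, j` is
`ϖ^{c_0 + ⋯ + c_i} v_{ij}`, of valuation `≤ |ϖ|^{c_0 + ⋯ + c_i}`; so `v` is integral, of determinant `1`, hence `v ∈ K₀`.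
[cite: BruhatTits1972, (4.4.4) (ii)] [cite: Macdonald1995, Ch. V (2.6)–(2.7)] -/
theorem coe_eq_coe_of_mem_orbit_of_iwasawaExp_eq (hd : UnramifiedLocalConjDatum σ ϖ) {c : Fin N → ℤ}
    (hc : Monotone c ∧ ∀ i, c (Fin.rev i) = -c i) {t : unitaryGroupOfForm σ ((StdForm.antidiagonal N).over K)}
    (ht : (t : GL (Fin N) K) = zpowDiagGL (uniformizer_ne_zero hd.vϖ) c)
    {g : unitaryGroupOfForm σ ((StdForm.antidiagonal N).over K)}
    (hg : (g : unitaryGroupOfForm σ ((StdForm.antidiagonal N).over K) ⧸ unitaryInt σ ((StdForm.antidiagonal N).over K)) ∈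
      MulAction.orbit (unitaryInt σ ((StdForm.antidiagonal N).over K))
        ((t : unitaryGroupOfForm σ ((StdForm.antidiagonal N).over K) ⧸ unitaryInt σ ((StdForm.antidiagonal N).over K))))
    (he : hd.iwasawaExp g = c) :
    (g : unitaryGroupOfForm σ ((StdForm.antidiagonal N).over K) ⧸ unitaryInt σ ((StdForm.antidiagonal N).over K)) =
      (t : unitaryGroupOfForm σ ((StdForm.antidiagonal N).over K) ⧸ unitaryInt σ ((StdForm.antidiagonal N).over K)) := by
  have hϖ := hd.vϖ
  have hϖ0 := uniformizer_ne_zero hϖ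
  obtain ⟨u, t', k, hu, ht', hk, hutk, k₁, k₂, hk₁, hk₂, hmat⟩ := hd.exists_upper_eq_mul_diagonal_mul hc ht hg
  have hanti : Antitone (fun j => -c j) := fun i j hij => neg_le_neg (hc.1 hij)
  have hc' : ∀ i, (fun j => -c j) (Fin.rev i) = -(fun j => -c j) i := fun i => by simp only [hc.2 i, neg_neg]
  rw [he] at ht'
  -- `t' = t`
  have htt : t' = t := Subtype.ext (by rw [ht', ht])
  rw [htt] at hutk hmat
  -- `v = t⁻¹ u t` is upper unitriangular
  set v : unitaryGroupOfForm σ ((StdForm.antidiagonal N).over K) := t⁻¹ * u * t with hv_def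
  have hvGL : (v : GL (Fin N) K) = (zpowDiagGL hϖ0 c)⁻¹ * (u : GL (Fin N) K) * zpowDiagGL hϖ0 c := by
    rw [hv_def, Subgroup.coe_mul, Subgroup.coe_mul, Subgroup.coe_inv, ht]
  have hvU : (v : GL (Fin N) K) ∈ upperUnitriangular (Fin N) K := by
    have := zpowDiagGL_mul_mul_inv_mem_upperUnitriangular hϖ0 (-c) hu
    rwa [zpowDiagGL_neg, inv_inv, ← hvGL] at this
  obtain ⟨hvT, hvD⟩ := (mem_upperUnitriangular_iff (v : GL (Fin N) K)).1 hvU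
  -- `u t = t v`, i.e. the matrix of `u t` is `diag(ϖ^c) · v`
  have hutv : u * t = t * v := by rw [hv_def]; group
  have hmatv : (((u * t : unitaryGroupOfForm σ ((StdForm.antidiagonal N).over K)) : GL (Fin N) K) : Matrix (Fin N) (Fin N) K) =
      (Matrix.diagonal fun i => ϖ ^ c i) * ((v : GL (Fin N) K) : Matrix (Fin N) (Fin N) K) := by
    rw [hutv, Subgroup.coe_mul, Units.val_mul, ht, coe_zpowDiagGL]
  -- `v` is integral: the minor argument
  have hvint : ∀ i j, Valued.v (((v : GL (Fin N) K) : Matrix (Fin N) (Fin N) K) i j) ≤ 1 := by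
    intro i j
    rcases lt_trichotomy i j with hij | rfl | hji
    · have hij' : (i : ℕ) < (j : ℕ) := hij
      have hi1 : (i : ℕ) + 1 ≤ N := by have := j.isLt; omega
      have h1 := v_det_submatrix_le_of_eq_mul_diagonal_mul hϖ hanti hk₁ hk₂ (mem_unitaryInt_iff.1 hk).2 hmat
        (fun l : Fin ((i : ℕ) + 1) => (⟨l, by omega⟩ : Fin N))
        (fun l : Fin ((i : ℕ) + 1) => if (l : ℕ) < (i : ℕ) then (⟨l, by omega⟩ : Fin N) else j)
      rw [hmatv] at h1
      have hsub : ((Matrix.diagonal fun i : Fin N => ϖ ^ c i) * ((v : GL (Fin N) K) : Matrix (Fin N) (Fin N) K)).submatrix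
          (fun l : Fin ((i : ℕ) + 1) => (⟨l, by omega⟩ : Fin N))
          (fun l : Fin ((i : ℕ) + 1) => if (l : ℕ) < (i : ℕ) then (⟨l, by omega⟩ : Fin N) else j) =
          Matrix.diagonal (fun l : Fin ((i : ℕ) + 1) => ϖ ^ c ⟨l, by omega⟩) *
            ((v : GL (Fin N) K) : Matrix (Fin N) (Fin N) K).submatrix (fun l : Fin ((i : ℕ) + 1) => (⟨l, by omega⟩ : Fin N))
              (fun l : Fin ((i : ℕ) + 1) => if (l : ℕ) < (i : ℕ) then (⟨l, by omega⟩ : Fin N) else j) := by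
        ext l m
        rw [Matrix.submatrix_apply, Matrix.diagonal_mul, Matrix.diagonal_mul, Matrix.submatrix_apply]
      rw [hsub, Matrix.det_mul, Matrix.det_diagonal, det_submatrix_castSucc_of_upperUnitriangular hvU hij, map_mul,
        map_prod] at h1
      simp_rw [v_uniformizer_zpow hϖ] at h1
      rw [prod_exp_neg_eq, sum_first_eq_sum_ite hi1 c, sum_ite_rev_eq_neg hc', sum_ite_lt_neg, neg_neg] at h1
      -- cancel the power of `|ϖ|`
      have hne : WithZero.exp (-∑ i' : Fin N, if (i' : ℕ) < (i : ℕ) + 1 then c i' else 0) ≠ 0 := WithZero.coe_ne_zero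
      have h3 := mul_le_mul_right h1 (WithZero.exp (-∑ i' : Fin N, if (i' : ℕ) < (i : ℕ) + 1 then c i' else 0))⁻¹
      rwa [inv_mul_cancel_left₀ hne, inv_mul_cancel₀ hne] at h3
    · rw [hvD i, map_one]
    · rw [hvT (show (id j) < (id i) from hji), map_zero]
      exact zero_le
  -- `v ∈ K₀`
  have hvdet : ((v : GL (Fin N) K) : Matrix (Fin N) (Fin N) K).det = 1 := by
    rw [Matrix.det_of_upperTriangular hvT, Finset.prod_eq_one fun i _ => hvD i]
  have hvK : v ∈ unitaryInt σ ((StdForm.antidiagonal N).over K) := by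
    refine mem_unitaryInt_iff.2 ⟨hvint, fun i j => ?_⟩
    rw [Matrix.coe_units_inv]
    exact v_inv_apply_le_one_of_det_eq_one hvint hvdet i j
  -- conclude: `g⁻¹ t = k⁻¹ v⁻¹ ∈ K₀`
  rw [QuotientGroup.eq, hutk]
  have hcalc : (u * t * k)⁻¹ * t = k⁻¹ * v⁻¹ := by
    rw [hv_def]
    group
  rw [hcalc]
  exact (unitaryInt σ _).mul_mem ((unitaryInt σ _).inv_mem hk) ((unitaryInt σ _).inv_mem hvK)

/-- (4.4.4) (ii) on cosets: a coset `γ ⊆ K₀ t K₀` (`(t : GL_N) = diag(ϖ^c)`, `c` monotone antisymmetric) with `a(γ) = c` IS `tK₀`.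
[cite: BruhatTits1972, (4.4.4) (ii)] -/
theorem eq_coe_of_mem_orbit_of_iwasawaExp_out_eq (hd : UnramifiedLocalConjDatum σ ϖ) {c : Fin N → ℤ}
    (hc : Monotone c ∧ ∀ i, c (Fin.rev i) = -c i) {t : unitaryGroupOfForm σ ((StdForm.antidiagonal N).over K)}
    (ht : (t : GL (Fin N) K) = zpowDiagGL (uniformizer_ne_zero hd.vϖ) c)
    {γ : unitaryGroupOfForm σ ((StdForm.antidiagonal N).over K) ⧸ unitaryInt σ ((StdForm.antidiagonal N).over K)}
    (hγ : γ ∈ MulAction.orbit (unitaryInt σ ((StdForm.antidiagonal N).over K))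
        ((t : unitaryGroupOfForm σ ((StdForm.antidiagonal N).over K) ⧸ unitaryInt σ ((StdForm.antidiagonal N).over K))))
    (he : hd.iwasawaExp γ.out = c) :
    γ = (t : unitaryGroupOfForm σ ((StdForm.antidiagonal N).over K) ⧸ unitaryInt σ ((StdForm.antidiagonal N).over K)) := by
  have hγ' : (γ.out : unitaryGroupOfForm σ ((StdForm.antidiagonal N).over K) ⧸ unitaryInt σ ((StdForm.antidiagonal N).over K)) ∈
      MulAction.orbit (unitaryInt σ ((StdForm.antidiagonal N).over K))
        ((t : unitaryGroupOfForm σ ((StdForm.antidiagonal N).over K) ⧸ unitaryInt σ ((StdForm.antidiagonal N).over K))) := by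
    rwa [QuotientGroup.out_eq']
  rw [← QuotientGroup.out_eq' γ]
  exact hd.coe_eq_coe_of_mem_orbit_of_iwasawaExp_eq hc ht hγ' he

/-! ## §5 The antidominant Cartan datum of `U(σ, J₀)` and the injectivity of the Satake transform over any commutative ring -/

/-- The exponents of a torus element `t` with `(t : GL_N) = diag(ϖ^c)`, `c` antisymmetric, are `a(t) = c`.
[cite: BruhatTits1972, (4.4.3)] -/
theorem iwasawaExp_eq_of_coe_eq_zpowDiagGL (hd : UnramifiedLocalConjDatum σ ϖ) {c : Fin N → ℤ}
    (hc : ∀ i, c (Fin.rev i) = -c i) {t : unitaryGroupOfForm σ ((StdForm.antidiagonal N).over K)}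
    (ht : (t : GL (Fin N) K) = zpowDiagGL (uniformizer_ne_zero hd.vϖ) c) : hd.iwasawaExp t = c := by
  have h : t = ⟨zpowDiagGL (uniformizer_ne_zero hd.vϖ) c, zpowDiagGL_mem_unitaryGroupOfForm hd.σϖ _ hc⟩ := Subtype.ext ht
  rw [h]
  exact hd.iwasawaExp_zpowDiagGL hc

/-- **(CARTAN) with ANTIDOMINANT representatives**: every coset `γ₀ ∈ U(σ, J₀)/K₀` has some `tK₀`, `(t : GL_N) = diag(ϖ^c)`
with `c` MONOTONE and antisymmetric, in its `K₀`-orbit (the antitone representative `diag(ϖ^b)` of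
`heckeCosetMk_zpowDiagGL_eq_of_unitary` inverted: `diag(ϖ^b)⁻¹ = P_rev diag(ϖ^b) P_rev⁻¹ ∈ K₀ diag(ϖ^b) K₀`).
[cite: BruhatTits1972, (4.4.3)] [cite: CartierCorvallis1979, §IV (4.2)] -/
theorem exists_zpowDiagGL_monotone_mem_orbit_unitary (hd : UnramifiedLocalConjDatum σ ϖ)
    (γ₀ : unitaryGroupOfForm σ ((StdForm.antidiagonal N).over K) ⧸ unitaryInt σ ((StdForm.antidiagonal N).over K)) :
    ∃ t ∈ {t : unitaryGroupOfForm σ ((StdForm.antidiagonal N).over K) | ∃ c : Fin N → ℤ,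
        Monotone c ∧ (∀ i, c (Fin.rev i) = -c i) ∧ (t : GL (Fin N) K) = zpowDiagGL (uniformizer_ne_zero hd.vϖ) c},
      (t : unitaryGroupOfForm σ ((StdForm.antidiagonal N).over K) ⧸ unitaryInt σ ((StdForm.antidiagonal N).over K)) ∈
        MulAction.orbit (unitaryInt σ ((StdForm.antidiagonal N).over K)) γ₀ := by
  have hϖ0 := uniformizer_ne_zero hd.vϖ
  obtain ⟨b, hb, hmk⟩ := heckeCosetMk_zpowDiagGL_eq_of_unitary hd γ₀.out
  obtain ⟨A, hA, B, hB, hAB⟩ := (heckeAlgebra.heckeCosetMk_eq_iff (unitaryInt σ ((StdForm.antidiagonal N).over K))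
    (Submonoid.mem_top _) (Submonoid.mem_top _)).1 hmk
  set tb : unitaryGroupOfForm σ ((StdForm.antidiagonal N).over K) :=
    ⟨zpowDiagGL hϖ0 b, zpowDiagGL_mem_unitaryGroupOfForm hd.σϖ _ hb.2⟩ with htb
  have hγorb : (γ₀.out : unitaryGroupOfForm σ ((StdForm.antidiagonal N).over K) ⧸ unitaryInt σ ((StdForm.antidiagonal N).over K)) ∈
      MulAction.orbit (unitaryInt σ ((StdForm.antidiagonal N).over K))
        ((tb : unitaryGroupOfForm σ ((StdForm.antidiagonal N).over K)) :
          unitaryGroupOfForm σ ((StdForm.antidiagonal N).over K) ⧸ unitaryInt σ ((StdForm.antidiagonal N).over K)) :=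
    (heckeAlgebra.coe_mem_orbit_coe_iff (unitaryInt σ ((StdForm.antidiagonal N).over K)) _ _).2 ⟨A, hA, B, hB, hAB⟩
  rw [QuotientGroup.out_eq'] at hγorb
  -- the longest Weyl element inverts `tb` inside its double coset
  have hrev : ∀ i : Fin N, (Fin.revPerm : Equiv.Perm (Fin N)) (Fin.rev i) = Fin.rev (Fin.revPerm i) := fun i => rfl
  set P : unitaryGroupOfForm σ ((StdForm.antidiagonal N).over K) :=
    ⟨permGL Fin.revPerm, permGL_mem_unitaryGroupOfForm Fin.revPerm hrev⟩ with hP_def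
  have hP : P ∈ unitaryInt σ ((StdForm.antidiagonal N).over K) := permGL_mem_unitaryInt (K := K) (σ := σ) Fin.revPerm hrev
  have hTinv : tb⁻¹ = P * tb * P⁻¹ := Subtype.ext (zpowDiagGL_inv_eq_conj_rev hϖ0 hb.2)
  have hinvorb : ((tb⁻¹ : unitaryGroupOfForm σ ((StdForm.antidiagonal N).over K)) :
        unitaryGroupOfForm σ ((StdForm.antidiagonal N).over K) ⧸ unitaryInt σ ((StdForm.antidiagonal N).over K)) ∈
      MulAction.orbit (unitaryInt σ ((StdForm.antidiagonal N).over K))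
        ((tb : unitaryGroupOfForm σ ((StdForm.antidiagonal N).over K)) :
          unitaryGroupOfForm σ ((StdForm.antidiagonal N).over K) ⧸ unitaryInt σ ((StdForm.antidiagonal N).over K)) :=
    (heckeAlgebra.coe_mem_orbit_coe_iff (unitaryInt σ ((StdForm.antidiagonal N).over K)) _ _).2
      ⟨P, hP, P⁻¹, (unitaryInt σ _).inv_mem hP, hTinv⟩
  refine ⟨tb⁻¹, ⟨fun j => -b j, fun i j hij => neg_le_neg (hb.1 hij), fun i => by simp only [hb.2 i, neg_neg], ?_⟩, ?_⟩
  · rw [Subgroup.coe_inv, htb, ← zpowDiagGL_neg]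
    rfl
  · rwa [← MulAction.orbit_eq_iff.2 hγorb] at hinvorb

/-- **(SEPARATION)**: `t ↦ a(t)` is injective on the antidominant representatives. [cite: CartierCorvallis1979, §IV (4.2)] -/
theorem injOn_iwasawaExp_zpowDiagGL_monotone_unitary (hd : UnramifiedLocalConjDatum σ ϖ) :
    Set.InjOn (hd.iwasawaExp (N := N)) {t : unitaryGroupOfForm σ ((StdForm.antidiagonal N).over K) | ∃ c : Fin N → ℤ,
      Monotone c ∧ (∀ i, c (Fin.rev i) = -c i) ∧ (t : GL (Fin N) K) = zpowDiagGL (uniformizer_ne_zero hd.vϖ) c} := by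
  rintro t ⟨c, -, hc, ht⟩ t' ⟨c', -, hc', ht'⟩ h
  rw [hd.iwasawaExp_eq_of_coe_eq_zpowDiagGL hc ht, hd.iwasawaExp_eq_of_coe_eq_zpowDiagGL hc' ht'] at h
  subst h
  exact Subtype.ext (ht.trans ht'.symm)

/-- **(DOMINANCE)**: for a coset `γ ⊆ K₀ t K₀` (`t` an antidominant representative with exponents `c`) either `a(γ) = c` or the
head-sum vector of `a(γ)` is lexicographically LARGER than that of `c` (smaller in the dual order).
[cite: BruhatTits1972, (4.4.4) (i)] -/
theorem iwasawaExp_eq_or_headSum_gt_unitary (hd : UnramifiedLocalConjDatum σ ϖ) :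
    ∀ t ∈ {t : unitaryGroupOfForm σ ((StdForm.antidiagonal N).over K) | ∃ c : Fin N → ℤ,
        Monotone c ∧ (∀ i, c (Fin.rev i) = -c i) ∧ (t : GL (Fin N) K) = zpowDiagGL (uniformizer_ne_zero hd.vϖ) c},
      ∀ γ ∈ MulAction.orbit (unitaryInt σ ((StdForm.antidiagonal N).over K))
          ((t : unitaryGroupOfForm σ ((StdForm.antidiagonal N).over K) ⧸ unitaryInt σ ((StdForm.antidiagonal N).over K))),
        hd.iwasawaExp γ.out = hd.iwasawaExp t ∨
          OrderDual.toDual (toLex (fun r : Fin N => ∑ i : Fin N, if (i : ℕ) < (r : ℕ) + 1 then hd.iwasawaExp γ.out i else 0)) <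
            OrderDual.toDual (toLex (fun r : Fin N => ∑ i : Fin N, if (i : ℕ) < (r : ℕ) + 1 then hd.iwasawaExp t i else 0)) := by
  rintro t ⟨c, hcm, hc, ht⟩ γ hγ
  rw [hd.iwasawaExp_eq_of_coe_eq_zpowDiagGL hc ht]
  have hγ' : (γ.out : unitaryGroupOfForm σ ((StdForm.antidiagonal N).over K) ⧸ unitaryInt σ ((StdForm.antidiagonal N).over K)) ∈
      MulAction.orbit (unitaryInt σ ((StdForm.antidiagonal N).over K))
        ((t : unitaryGroupOfForm σ ((StdForm.antidiagonal N).over K) ⧸ unitaryInt σ ((StdForm.antidiagonal N).over K))) := by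
    rwa [QuotientGroup.out_eq']
  have hle : ∀ r : ℕ, (∑ i : Fin N, if (i : ℕ) < r then c i else 0) ≤
      ∑ i : Fin N, if (i : ℕ) < r then hd.iwasawaExp γ.out i else 0 :=
    fun r => hd.sum_ite_lt_le_sum_iwasawaExp_of_mem_orbit ⟨hcm, hc⟩ ht hγ' r
  rcases (toLex_headSum_le_of_forall_le hle).lt_or_eq with hlt | heq
  · exact Or.inr (OrderDual.toDual_lt_toDual.2 hlt)
  · exact Or.inl (eq_of_forall_le_of_toLex_le hle heq.symm.le).symm

/-- **(UNIQUENESS)** = Bruhat–Tits (4.4.4) (ii) for `U(σ, J₀)` in the form used by the abstract injectivity criterion of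
`CartanIwasawaUniquenessGL`. [cite: BruhatTits1972, (4.4.4) (ii)] -/
theorem eq_coe_of_mem_orbit_zpowDiagGL_monotone_unitary (hd : UnramifiedLocalConjDatum σ ϖ) :
    ∀ t ∈ {t : unitaryGroupOfForm σ ((StdForm.antidiagonal N).over K) | ∃ c : Fin N → ℤ,
        Monotone c ∧ (∀ i, c (Fin.rev i) = -c i) ∧ (t : GL (Fin N) K) = zpowDiagGL (uniformizer_ne_zero hd.vϖ) c},
      ∀ γ ∈ MulAction.orbit (unitaryInt σ ((StdForm.antidiagonal N).over K))
          ((t : unitaryGroupOfForm σ ((StdForm.antidiagonal N).over K) ⧸ unitaryInt σ ((StdForm.antidiagonal N).over K))),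
        hd.iwasawaExp γ.out = hd.iwasawaExp t →
          γ = (t : unitaryGroupOfForm σ ((StdForm.antidiagonal N).over K) ⧸ unitaryInt σ ((StdForm.antidiagonal N).over K)) := by
  rintro t ⟨c, hcm, hc, ht⟩ γ hγ he
  rw [hd.iwasawaExp_eq_of_coe_eq_zpowDiagGL hc ht] at he
  exact hd.eq_coe_of_mem_orbit_of_iwasawaExp_out_eq ⟨hcm, hc⟩ ht hγ he

/-- **THE SATAKE TRANSFORM OF `ℋ(U(σ, J₀), K₀; R)` IS INJECTIVE FOR EVERY WEIGHT AND EVERY COMMUTATIVE COEFFICIENT RING `R`**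
(`K` any field with `Valued K ℤᵐ⁰` carrying an `UnramifiedLocalConjDatum σ ϖ`; no finiteness of the residue field, no domain or
characteristic hypothesis on `R`): Cartier's linear-independence argument with the antidominant Cartan representatives, whose
bottom coset is unique by (4.4.4) (ii).  The tree's `satakeTransform_injective` (`HyperspecialUnitarySatakeInjective`) is
the case of the `ℂ`-valued transform `hd.satakeTransform`. [cite: CartierCorvallis1979, §IV Thm. 4.1 (injectivity half)]
[cite: BruhatTits1972, (4.4.4) (i), (ii)] -/
theorem satakeTransform_injective_of_commRing (hd : UnramifiedLocalConjDatum σ ϖ) {R : Type*} [CommRing R]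
    (w : Multiplicative (Fin N → ℤ) →* R) :
    Function.Injective ((hd.isIwasawaExponent (N := N)).satakeTransform w) :=
  (hd.isIwasawaExponent (N := N)).satakeTransform_injective_of_unique w
    (φ := fun μ : Fin N → ℤ =>
      OrderDual.toDual (toLex (fun r : Fin N => ∑ i : Fin N, if (i : ℕ) < (r : ℕ) + 1 then μ i else 0)))
    hd.exists_zpowDiagGL_monotone_mem_orbit_unitary hd.injOn_iwasawaExp_zpowDiagGL_monotone_unitary
    hd.iwasawaExp_eq_or_headSum_gt_unitary hd.eq_coe_of_mem_orbit_zpowDiagGL_monotone_unitary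

/-- Injectivity as a kernel statement: `𝒮_w(T) = 0 ⇒ T = 0` in `ℋ(U(σ, J₀), K₀; R)`, any commutative `R`.
[cite: CartierCorvallis1979, §IV Thm. 4.1 (injectivity half)] -/
theorem eq_zero_of_satakeTransform_eq_zero_of_commRing (hd : UnramifiedLocalConjDatum σ ϖ) {R : Type*} [CommRing R]
    (w : Multiplicative (Fin N → ℤ) →* R)
    {T : heckeAlgebra R (unitaryGroupOfForm σ ((StdForm.antidiagonal N).over K)) (unitaryInt σ ((StdForm.antidiagonal N).over K))}
    (hT : (hd.isIwasawaExponent (N := N)).satakeTransform w T = 0) : T = 0 :=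
  hd.satakeTransform_injective_of_commRing w (by rw [hT, map_zero])

/-! ## §6 The bottom coefficient of the transform of a Cartan double coset is the unit weight -/

variable [IsHeckeTriple (⊤ : Submonoid (unitaryGroupOfForm σ ((StdForm.antidiagonal N).over K)))
  (unitaryInt σ ((StdForm.antidiagonal N).over K)) (unitaryInt σ ((StdForm.antidiagonal N).over K))]

/-- **The bottom coefficient of `𝒮_w(T_t)` is the unit `w(c)`** (`(t : GL_N) = diag(ϖ^c)`, `c` monotone antisymmetric; any
weight, any commutative ring): the coefficient of `x^c` in the transform of the double-coset operator of `K₀ t K₀` is `w(c)` —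
exactly ONE coset of `K₀ t K₀` has exponents `c`. [cite: CartierCorvallis1979, §IV, proof of Thm. 4.1 (c)]
[cite: BruhatTits1972, (4.4.4) (ii)] -/
theorem coeff_satakeTransform_doubleCosetOperator_zpowDiagGL_monotone_unitary (hd : UnramifiedLocalConjDatum σ ϖ)
    {R : Type*} [CommRing R] (w : Multiplicative (Fin N → ℤ) →* R) {c : Fin N → ℤ}
    (hc : Monotone c ∧ ∀ i, c (Fin.rev i) = -c i) {t : unitaryGroupOfForm σ ((StdForm.antidiagonal N).over K)}
    (ht : (t : GL (Fin N) K) = zpowDiagGL (uniformizer_ne_zero hd.vϖ) c) :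
    ((hd.isIwasawaExponent (N := N)).satakeTransform w
        (heckeAlgebra.doubleCosetOperator (unitaryInt σ ((StdForm.antidiagonal N).over K)) t)).coeff c =
      w (Multiplicative.ofAdd c) := by
  have h := (hd.isIwasawaExponent (N := N)).coeff_self_satakeTransform_doubleCosetOperator_of_unique w (t := t)
    (fun γ hγ he => hd.eq_coe_of_mem_orbit_of_iwasawaExp_out_eq hc ht hγ
      (he.trans (hd.iwasawaExp_eq_of_coe_eq_zpowDiagGL hc.2 ht)))
  rwa [hd.iwasawaExp_eq_of_coe_eq_zpowDiagGL hc.2 ht] at h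

/-- **Exactly one coset of `K₀ t K₀` has the antidominant exponents `c`** (`(t : GL_N) = diag(ϖ^c)`, `c` monotone antisymmetric).
[cite: BruhatTits1972, (4.4.4) (ii)] -/
theorem card_filter_iwasawaExp_orbit_eq_one_unitary (hd : UnramifiedLocalConjDatum σ ϖ) {c : Fin N → ℤ}
    (hc : Monotone c ∧ ∀ i, c (Fin.rev i) = -c i) {t : unitaryGroupOfForm σ ((StdForm.antidiagonal N).over K)}
    (ht : (t : GL (Fin N) K) = zpowDiagGL (uniformizer_ne_zero hd.vϖ) c)
    [DecidablePred fun γ : unitaryGroupOfForm σ ((StdForm.antidiagonal N).over K) ⧸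
      unitaryInt σ ((StdForm.antidiagonal N).over K) => hd.iwasawaExp γ.out = c] :
    ((finite_orbit_quotient (unitaryInt σ ((StdForm.antidiagonal N).over K)) t).toFinset.filter
        fun γ => hd.iwasawaExp γ.out = c).card = 1 := by
  rw [Finset.card_eq_one]
  refine ⟨(t : unitaryGroupOfForm σ ((StdForm.antidiagonal N).over K) ⧸ unitaryInt σ ((StdForm.antidiagonal N).over K)), ?_⟩
  ext γ
  rw [Finset.mem_filter, Set.Finite.mem_toFinset, Finset.mem_singleton]
  constructor
  · rintro ⟨hγ, he⟩
    exact hd.eq_coe_of_mem_orbit_of_iwasawaExp_out_eq hc ht hγ he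
  · rintro rfl
    exact ⟨MulAction.mem_orbit_self _, (hd.iwasawaExp_out_coe _).trans (hd.iwasawaExp_eq_of_coe_eq_zpowDiagGL hc.2 ht)⟩

/-- **The `ℂ`-valued transform `hd.satakeTransform` (weight `(√q)^{-⟨ν, ·⟩}`)**: the coefficient of `x^c` in `𝒮(T_t)` is
`(√q)^{-⟨ν, c⟩} = satakeWeight (√q) c` — multiplicity one, sharpening the tree's
`coeff_self_satakeTransform_doubleCosetOperator_ne_zero` (which has the DOMINANT exponent and `≠ 0` only).
[cite: CartierCorvallis1979, §IV (4.2), proof of Thm. 4.1 (c)] [cite: BruhatTits1972, (4.4.4) (ii)] -/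
theorem coeff_unitarySatakeTransform_doubleCosetOperator_zpowDiagGL_monotone [Finite 𝓀[K]] (hd : UnramifiedLocalConjDatum σ ϖ)
    {c : Fin N → ℤ} (hc : Monotone c ∧ ∀ i, c (Fin.rev i) = -c i)
    {t : unitaryGroupOfForm σ ((StdForm.antidiagonal N).over K)} (ht : (t : GL (Fin N) K) = zpowDiagGL (uniformizer_ne_zero hd.vϖ) c) :
    (hd.satakeTransform (heckeAlgebra.doubleCosetOperator (unitaryInt σ ((StdForm.antidiagonal N).over K)) t)).coeff c =
      satakeWeight (residueCardSqrt K) c := by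
  rw [hd.satakeTransform_eq_isIwasawaExponent_satakeTransform,
    hd.coeff_satakeTransform_doubleCosetOperator_zpowDiagGL_monotone_unitary _ hc ht, satakeWeightHom_ofAdd]

end UnramifiedLocalConjDatum

end Literature.NumberTheory.Automorphic.HermitianLattice

end
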